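import Summits.QuantumFields.YangMills.Theorems.FluctuationComparisonRegPrIntLS2BetaTubeLettersSeamSectors
import Summits.QuantumFields.YangMills.Theorems.UnitScaleTiltProp7SymCentreCentralGauge
import Summits.QuantumFields.YangMills.Theorems.UnitScaleTiltRegPrNotWindowOrbit
import Literature.MathematicalPhysics.QuantumFieldTheory.Balaban1983to89.B5Positivity172Lattice
import HarnessLib

/-!
# (RG-K) THE ℤ₂ SEAM TWIST, V — THE ℤ₂ NORMAL FORM: every `2`-small datum all of whose closed-walk holonomies are central («case B») IS a gauge
# transform of one of the eight seam sectors `ζ_l`; hence TUBE♭ ∕ GAP♭ OUTRIGHT AT EVERY CASE-B WINDOW DATUM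

Helper for crux `stmt-QuantumFields-20520` (`Theses.UnitScaleTilt.FluctuationComparisonRegPrIntL`), the (T)-chain of LINE
`semiclassical_s2beta` (cell `ym3-torus`, width seat «width 16» px16 g18).  Closes the identification left HONEST-open in parts III–IV
(✓`…S2BetaTubeLettersSeamTwist`, ✓`…S2BetaTubeLettersSeamSectors`).

* §0 the centre of `SU(2)` read in `ZMod 2`: `eq_one_or_eq_negOne_of_central` (commuting with all `2 × 2` matrices ⇒ `±1`), the sign dictionary
  `a ↦ (if a = 0 then 1 else −1)` (`sgn_eq_one_iff`, `eq_sgn`, `prod_eq_sgn` — a plaquette product of four signs is the sign of the `ZMod 2` plaquette sum,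
  `sgn_gauge_identity`).
* §1 (any `Params P`, any level `j`; the torus `T^{(j)}` as the charted torus lit ✓`B5Positivity172Lattice.chart` = ✓`TorusChart.pi`):
  `plaqHol_eq_sgn_d₁` ∕ `isFlat_bits` — a `±1`-valued plaquette-flat field is a FLAT `ZMod 2` `1`-cochain; `seamFold_apply` — the iterated seam twist of a
  duplicate-free list `l` multiplies the bond `b` by `−1` iff `b.dir ∈ l` and `b` wraps; ★★★ `exists_gauge_seamFold_of_flat` — THE ℤ₂ NORMAL FORM: a
  `±1`-valued plaquette-flat `S` equals `g • ζ_l` with `g` `±1`-valued and `l ⊆ [0, …, d−1]` duplicate-free (lit ✓`TorusChart.eq_d₀_prim_add_seam_wind`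
  with `A := ZMod 2`: `g := sgn ∘ prim`, `l :=` the directions of non-zero winding); `plaqHol_eq_one_of_central` — central + `PlaqSmall δ`, `δ ≤ 2` ⇒
  plaquette-flat (✓`dist1_negOne_eq_two`); ★★★ `exists_gauge_seamFold_of_loopHol_central` — with ✓`exists_gauge_centralValued_of_loopHol_central`:
  EVERY CASE-B `2`-SMALL DATUM is `g • ζ_l` for some gauge `g` and some duplicate-free `l`.
* §2 the T³ family: ★★★★ `exists_tubeGrowth_caseB` ∕ ★★★★ `exists_gapFlat_caseB` — ✓part IV's `exists_tubeGrowth_seamSector` ∕ `exists_gapFlat_seamSector`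
  read at the datum itself: for EVERY window-level datum `V` with central closed-walk holonomies and `PlaqSmall δ V`, `δ ≤ 2`, there are `g`, `l` with
  `V = g • ζ_l^J` and TUBE♭ ∕ GAP♭ hold OUTRIGHT at `(V, (liftTransfTo g) • ζ_l^K)` — same `γ₁(L, b₀, p₀[, δ'])`, same `μ` as ✓p799103 at `(1,1)`; NO letter,
  any `L`.

HONEST: finite-group ∕ `ZMod 2` ∕ lattice bookkeeping over landed letters and the tree's discrete de Rham theorem; nothing of Bałaban's analysis; the
base point is the flat representative `(liftTransfTo g) • ζ_l^K` of the fibre (the constrained minimiser there — action `0`), not an arbitrary minimiser;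
this file proves NO stub of the line — TUBE-REG∘ (K-uniform `μ`, universal `δ`), GAP♯∘, EXW∘, S2β and crux 20520 stay OPEN; rung R3 (YM₃ on T³) is NOT
d = 4, NOT infinite volume, NOT a mass gap, NOT Clay; the Yang–Mills mass gap is NOT proved.
-/

set_option autoImplicit false

noncomputable section

open Set Function
open scoped Matrix.Norms.L2Operator
open Literature.MathematicalPhysics.QuantumFieldTheory (TorusChart)
open Literature.MathematicalPhysics.QuantumFieldTheory.Balaban1983to89
open Literature.MathematicalPhysics.QuantumFieldTheory.Balaban1983to89.T3ContinuumYM3Torus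
open Literature.MathematicalPhysics.QuantumFieldTheory.Balaban1983to89.T3UnitLawDensityEML (ℰp)
open Literature.MathematicalPhysics.QuantumFieldTheory.Balaban1983to89.T3UnitScaleTilt
open Literature.MathematicalPhysics.QuantumFieldTheory.Balaban1983to89.T3TiltDescent
open Literature.MathematicalPhysics.QuantumFieldTheory.Balaban1983to89.T3ConstrainedMinimiser (fibre)
open Literature.MathematicalPhysics.QuantumFieldTheory.Balaban1983to89.T3PrintedRegularMinimiser
open Literature.MathematicalPhysics.QuantumFieldTheory.Balaban1983to89.T3PrintedRegularOrbits
open scoped Literature.MathematicalPhysics.QuantumFieldTheory.Balaban1983to89.T3OrbitAverage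
open Literature.MathematicalPhysics.QuantumFieldTheory.Balaban1983to89.ExpMeanLog (deltaSU)
open Literature.MathematicalPhysics.QuantumFieldTheory.Balaban1983to89.T4Continuum
open Literature.MathematicalPhysics.QuantumFieldTheory.Balaban1983to89.B5Positivity172Lattice (TT chart toT ofT shift_eq)
open Summit.QuantumFields.YangMills.Theorems.FluctuationComparisonRegPrIntLS2BetaCriticalOrbitUnique (negOne_mul_comm negOne_mul_negOne)
open Summit.QuantumFields.YangMills.Theorems.BrascampLiebVacuumSC.DimensionGapSU2 (neg_one_mem)
open Summit.QuantumFields.YangMills.Theorems.RegPrNotWindowOrbit (dist1_negOne_eq_two)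
open Literature.MathematicalPhysics.QuantumFieldTheory.Balaban1983to89.T3UnitLawGaugeInvariance (gaugeAct_gaugeAct)
open Summit.QuantumFields.YangMills.Theorems.Prop7SymCentreCentralGauge (exists_gauge_centralValued_of_loopHol_central)
open Summit.QuantumFields.YangMills.Theorems.FluctuationComparisonRegPrIntLS2BetaSeamTwistWords (inv_eq_self_of_sq)
open Summit.QuantumFields.YangMills.Theorems.FluctuationComparisonRegPrIntLS2BetaTubeLettersSeamSectors (exists_tubeGrowth_seamSector exists_gapFlat_seamSector)

namespace Summit.QuantumFields.YangMills.Theorems.FluctuationComparisonRegPrIntLS2BetaSeamSectorNormalForm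

/-! ## §0 The centre `{1, −1}` of `SU(2)` read in `ZMod 2` -/

section Centre

/-- `−1 ≠ 1` in `SU(2)`. [folklore] -/
theorem negOne_ne_one : (⟨-1, neg_one_mem⟩ : Matrix.specialUnitaryGroup (Fin 2) ℂ) ≠ 1 := by
  intro h
  have h00 := congrArg (fun g : Matrix.specialUnitaryGroup (Fin 2) ℂ => (g : Matrix (Fin 2) (Fin 2) ℂ) 0 0) h
  have h' : (-1 : ℂ) = 1 := by simpa using h00
  norm_num at h'

/-- `(−1)⁻¹ = −1` in `SU(2)`. [folklore] -/
theorem negOne_inv : (⟨-1, neg_one_mem⟩ : Matrix.specialUnitaryGroup (Fin 2) ℂ)⁻¹ = ⟨-1, neg_one_mem⟩ :=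
  inv_eq_of_mul_eq_one_right negOne_mul_negOne

/-- **The centre of `SU(2)` is `{1, −1}`**: an element commuting with every `2 × 2` matrix is `±1`. [folklore] -/
theorem eq_one_or_eq_negOne_of_central (g : Matrix.specialUnitaryGroup (Fin 2) ℂ)
    (h : ∀ M : Matrix (Fin 2) (Fin 2) ℂ, Commute ((g : Matrix.specialUnitaryGroup (Fin 2) ℂ) : Matrix (Fin 2) (Fin 2) ℂ) M) :
    g = 1 ∨ g = ⟨-1, neg_one_mem⟩ := by
  have e1 := (h (Matrix.of ![![0, 1], ![0, 0]])).eq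
  have e2 := (h (Matrix.of ![![0, 0], ![1, 0]])).eq
  have h10 : (g : Matrix (Fin 2) (Fin 2) ℂ) 1 0 = 0 := by
    simpa [Matrix.mul_apply, Fin.sum_univ_two] using (congrFun (congrFun e1 0) 0).symm
  have hd : (g : Matrix (Fin 2) (Fin 2) ℂ) 0 0 = (g : Matrix (Fin 2) (Fin 2) ℂ) 1 1 := by
    simpa [Matrix.mul_apply, Fin.sum_univ_two] using congrFun (congrFun e1 0) 1
  have h01 : (g : Matrix (Fin 2) (Fin 2) ℂ) 0 1 = 0 := by
    simpa [Matrix.mul_apply, Fin.sum_univ_two] using congrFun (congrFun e2 0) 0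
  have hdet : ((g : Matrix (Fin 2) (Fin 2) ℂ)).det = 1 := g.prop.2
  rw [Matrix.det_fin_two, h01, h10, ← hd, mul_zero, sub_zero] at hdet
  rcases mul_self_eq_one_iff.mp hdet with h1 | h1
  · left
    apply Subtype.ext
    ext i j
    fin_cases i <;> fin_cases j <;> simp [h01, h10, ← hd, h1]
  · right
    apply Subtype.ext
    ext i j
    fin_cases i <;> fin_cases j <;> simp [h01, h10, ← hd, h1]

/-- The sign of a bit is `1` iff the bit is `0`. [folklore] -/
theorem sgn_eq_one_iff (a : ZMod 2) : (if a = 0 then (1 : Matrix.specialUnitaryGroup (Fin 2) ℂ) else (⟨-1, neg_one_mem⟩ : Matrix.specialUnitaryGroup (Fin 2) ℂ)) = 1 ↔ a = 0 := by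
  constructor
  · intro h
    by_contra ha
    rw [if_neg ha] at h
    exact negOne_ne_one h
  · intro h
    rw [if_pos h]

/-- A central element is the sign of its bit. [folklore] -/
theorem eq_sgn (g : Matrix.specialUnitaryGroup (Fin 2) ℂ) (h : g = 1 ∨ g = ⟨-1, neg_one_mem⟩) :
    g = (if (if g = 1 then (0 : ZMod 2) else 1) = 0 then (1 : Matrix.specialUnitaryGroup (Fin 2) ℂ) else (⟨-1, neg_one_mem⟩ : Matrix.specialUnitaryGroup (Fin 2) ℂ)) := by
  rcases h with rfl | rfl
  · simp
  · rw [if_neg negOne_ne_one, if_neg one_ne_zero]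

/-- **A plaquette-shaped product of four signs is the sign of the `ZMod 2` plaquette sum.** [folklore] -/
theorem prod_eq_sgn (a b c d : Matrix.specialUnitaryGroup (Fin 2) ℂ)
    (ha : a = 1 ∨ a = ⟨-1, neg_one_mem⟩) (hb : b = 1 ∨ b = ⟨-1, neg_one_mem⟩)
    (hc : c = 1 ∨ c = ⟨-1, neg_one_mem⟩) (hd : d = 1 ∨ d = ⟨-1, neg_one_mem⟩) :
    a * b * c⁻¹ * d⁻¹ =
      (if (if a = 1 then (0 : ZMod 2) else 1) + (if b = 1 then (0 : ZMod 2) else 1) -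
            (if c = 1 then (0 : ZMod 2) else 1) - (if d = 1 then (0 : ZMod 2) else 1) = 0 then (1 : Matrix.specialUnitaryGroup (Fin 2) ℂ) else (⟨-1, neg_one_mem⟩ : Matrix.specialUnitaryGroup (Fin 2) ℂ)) := by
  have h11 : (1 : ZMod 2) + 1 = 0 := by decide
  have hm1 : (-1 : ZMod 2) = 1 := by decide
  have hne := negOne_ne_one
  rcases ha with rfl | rfl <;> rcases hb with rfl | rfl <;> rcases hc with rfl | rfl <;> rcases hd with rfl | rfl <;>
    simp only [hne, ↓reduceIte, one_ne_zero, add_zero, zero_add, sub_zero, sub_self, zero_sub, h11, hm1,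
      one_mul, mul_one, inv_one, negOne_inv, negOne_mul_negOne]

/-- **The gauge identity of the normal form, bit by bit**: `sgn(B − A + W') = sgn A · Z · (sgn B)⁻¹` where `Z = −1` iff the seam bit `W'` is on. [folklore] -/
theorem sgn_gauge_identity (A B W : ZMod 2) (wrap : Prop) [Decidable wrap] :
    (if B - A + (if wrap then W else 0) = 0 then (1 : Matrix.specialUnitaryGroup (Fin 2) ℂ) else (⟨-1, neg_one_mem⟩ : Matrix.specialUnitaryGroup (Fin 2) ℂ)) =
      (if A = 0 then (1 : Matrix.specialUnitaryGroup (Fin 2) ℂ) else (⟨-1, neg_one_mem⟩ : Matrix.specialUnitaryGroup (Fin 2) ℂ)) * ((if (¬ W = 0 ∧ wrap) then (⟨-1, neg_one_mem⟩ : Matrix.specialUnitaryGroup (Fin 2) ℂ) else 1) * 1) * (if B = 0 then (1 : Matrix.specialUnitaryGroup (Fin 2) ℂ) else (⟨-1, neg_one_mem⟩ : Matrix.specialUnitaryGroup (Fin 2) ℂ))⁻¹ := by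
  have h11 : (1 : ZMod 2) + 1 = 0 := by decide
  have hm1 : (-1 : ZMod 2) = 1 := by decide
  have hz : ∀ a : ZMod 2, a = 0 ∨ a = 1 := by decide
  by_cases hw : wrap <;>
  rcases hz A with rfl | rfl <;> rcases hz B with rfl | rfl <;> rcases hz W with rfl | rfl <;>
    simp only [hw, ↓reduceIte, one_ne_zero, not_true_eq_false, not_false_eq_true, and_true, and_false,
      add_zero, zero_add, sub_zero, sub_self, zero_sub, h11, hm1,
      one_mul, mul_one, inv_one, negOne_inv, negOne_mul_negOne]

end Centre

/-! ## §1 `±1`-valued plaquette-flat fields on `T^{(j)}` are gauge transforms of seam sectors -/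

section NormalForm

variable {P : Params} {j : ℕ}

/-- **The iterated seam twist of a duplicate-free list, bond by bond**: the bond `b` is multiplied by `n1` iff its direction is listed and it wraps.
[folklore] -/
theorem seamFold_apply {G : Type*} [GaugeGroup G] (n1 : G) (U : GaugeField P j G) (b : PBond P j) :
    ∀ l : List (Fin P.d), l.Nodup →
      (l.foldr (fun (ν : Fin P.d) (X : GaugeField P j G) => fun b' : PBond P j =>
        (if b'.dir = ν ∧ (b'.src ν).val + 1 = P.sitesPerDir j then n1 else 1) * X b') U) b =
      (if b.dir ∈ l ∧ (b.src b.dir).val + 1 = P.sitesPerDir j then n1 else 1) * U b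
  | [], _ => by simp
  | ν :: l, hl => by
    simp only [List.foldr_cons]
    rw [seamFold_apply n1 U b l (List.nodup_cons.1 hl).2]
    by_cases hb : b.dir = ν
    · subst hb
      have hnot : b.dir ∉ l := (List.nodup_cons.1 hl).1
      simp [hnot]
    · have hmem : (b.dir ∈ ν :: l) ↔ b.dir ∈ l := by simp [List.mem_cons, hb]
      simp only [hb, false_and, ↓reduceIte, one_mul, hmem]

/-- **The plaquette variable of a `±1`-valued field is the sign of the `ZMod 2` plaquette sum `d₁ θ` of its bit cochain `θ`** (the torus `T^{(j)}` charted by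
lit ✓`chart P j`; lit ✓`shift_eq`). [cite: Balaban1984PropagatorsI, (1.2) p.18] -/
theorem plaqHol_eq_sgn_d₁ (S : GaugeField P j (Matrix.specialUnitaryGroup (Fin 2) ℂ)) (hS : ∀ c, S c = 1 ∨ S c = ⟨-1, neg_one_mem⟩) (p : Plaq P j) :
    GaugeField.plaqHol S p =
      (if (chart P j).d₁ (fun (x : TT P j) (μ : Fin P.d) => if S ⟨ofT x, μ⟩ = 1 then (0 : ZMod 2) else 1) (toT p.src) p.μ p.ν = 0 then (1 : Matrix.specialUnitaryGroup (Fin 2) ℂ) else (⟨-1, neg_one_mem⟩ : Matrix.specialUnitaryGroup (Fin 2) ℂ)) := by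
  rw [TorusChart.d₁_apply]
  unfold GaugeField.plaqHol
  rw [shift_eq p.src p.μ, shift_eq p.src p.ν]
  exact prod_eq_sgn _ _ _ _ (hS _) (hS _) (hS _) (hS _)

/-- **A `±1`-valued plaquette-flat field has a FLAT bit cochain.** [folklore] -/
theorem isFlat_bits (S : GaugeField P j (Matrix.specialUnitaryGroup (Fin 2) ℂ)) (hS : ∀ c, S c = 1 ∨ S c = ⟨-1, neg_one_mem⟩)
    (hflat : ∀ p : Plaq P j, GaugeField.plaqHol S p = 1) :
    (chart P j).IsFlat (fun (x : TT P j) (μ : Fin P.d) => if S ⟨ofT x, μ⟩ = 1 then (0 : ZMod 2) else 1) := by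
  intro x μ ν
  rcases lt_trichotomy μ ν with hlt | rfl | hgt
  · have h := hflat ⟨ofT x, μ, ν, hlt⟩
    rw [plaqHol_eq_sgn_d₁ S hS, sgn_eq_one_iff] at h
    exact h
  · rw [TorusChart.d₁_apply]
    abel
  · have h := hflat ⟨ofT x, ν, μ, hgt⟩
    rw [plaqHol_eq_sgn_d₁ S hS, sgn_eq_one_iff, TorusChart.d₁_apply] at h
    rw [TorusChart.d₁_apply]
    dsimp only [toT, ofT] at h ⊢
    linear_combination -h

/-- ★★★ **THE ℤ₂ NORMAL FORM**: a `±1`-valued plaquette-flat field on `T^{(j)}` is a `±1`-valued gauge transform of the iterated seam twist `ζ_l` of a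
duplicate-free list of directions (lit ✓`TorusChart.eq_d₀_prim_add_seam_wind` with `A := ZMod 2`; `g := sgn ∘ prim θ`, `l :=` the directions of
non-zero winding of the bit cochain `θ`). [folklore] -/
theorem exists_gauge_seamFold_of_flat (S : GaugeField P j (Matrix.specialUnitaryGroup (Fin 2) ℂ)) (hS : ∀ c, S c = 1 ∨ S c = ⟨-1, neg_one_mem⟩)
    (hflat : ∀ p : Plaq P j, GaugeField.plaqHol S p = 1) :
    ∃ (g : GaugeTransf P j (Matrix.specialUnitaryGroup (Fin 2) ℂ)) (l : List (Fin P.d)), l.Nodup ∧ (∀ x, g x = 1 ∨ g x = ⟨-1, neg_one_mem⟩) ∧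
      S = GaugeField.gaugeAct g (l.foldr (fun (ν : Fin P.d) (X : GaugeField P j (Matrix.specialUnitaryGroup (Fin 2) ℂ)) => fun b : PBond P j =>
        (if b.dir = ν ∧ (b.src ν).val + 1 = P.sitesPerDir j then (⟨-1, neg_one_mem⟩ : Matrix.specialUnitaryGroup (Fin 2) ℂ) else 1) * X b) (1 : GaugeField P j (Matrix.specialUnitaryGroup (Fin 2) ℂ))) := by
  have hθ := isFlat_bits S hS hflat
  have hstr := TorusChart.eq_d₀_prim_add_seam_wind hθ
  refine ⟨fun x => (if (chart P j).prim (fun (x : TT P j) (μ : Fin P.d) => if S ⟨ofT x, μ⟩ = 1 then (0 : ZMod 2) else 1) (toT x) = 0 then (1 : Matrix.specialUnitaryGroup (Fin 2) ℂ) else (⟨-1, neg_one_mem⟩ : Matrix.specialUnitaryGroup (Fin 2) ℂ)),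
    (List.finRange P.d).filter (fun μ => decide (¬ (chart P j).wind (fun (x : TT P j) (μ : Fin P.d) => if S ⟨ofT x, μ⟩ = 1 then (0 : ZMod 2) else 1) μ = 0)),
    (List.nodup_finRange P.d).filter _, fun x => ?_, ?_⟩
  · dsimp only
    split_ifs
    · exact Or.inl rfl
    · exact Or.inr rfl
  funext b
  rw [show GaugeField.gaugeAct _ _ b = _ * _ * (_ : Matrix.specialUnitaryGroup (Fin 2) ℂ)⁻¹ from rfl, seamFold_apply _ _ b _ ((List.nodup_finRange P.d).filter _),
    show (1 : GaugeField P j (Matrix.specialUnitaryGroup (Fin 2) ℂ)) b = 1 from rfl]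
  simp only [List.mem_filter, List.mem_finRange, true_and, decide_eq_true_eq]
  have hSb : S b = (if (fun (x : TT P j) (μ : Fin P.d) => if S ⟨ofT x, μ⟩ = 1 then (0 : ZMod 2) else 1) (toT b.src) b.dir = 0 then (1 : Matrix.specialUnitaryGroup (Fin 2) ℂ) else (⟨-1, neg_one_mem⟩ : Matrix.specialUnitaryGroup (Fin 2) ℂ)) := eq_sgn (S b) (hS b)
  have hθb := congrFun (congrFun hstr (toT b.src)) b.dir
  rw [Pi.add_apply, Pi.add_apply, TorusChart.d₀_apply, TorusChart.seam_apply] at hθb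
  rw [hSb]
  beta_reduce
  rw [hθb]
  have htgt : toT (PBond.tgt b) = toT b.src + (chart P j).gen b.dir := by
    rw [PBond.tgt, shift_eq]
  rw [htgt]
  simp only [TorusChart.pi_cval, TorusChart.pi_period]
  exact sgn_gauge_identity _ _ _ _

/-- **Central + `2`-small ⇒ plaquette-flat**: a `±1`-valued field with `PlaqSmall δ`, `δ ≤ 2`, has all plaquette variables `1` (`dist1 (−1) = 2`).
[cite: Balaban1985Variational, (6) p.278] -/
theorem plaqHol_eq_one_of_central (S : GaugeField P j (Matrix.specialUnitaryGroup (Fin 2) ℂ)) (hS : ∀ c, S c = 1 ∨ S c = ⟨-1, neg_one_mem⟩)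
    {δ : ℝ} (hδ : δ ≤ 2) (hsmall : PlaqSmall δ S) (p : Plaq P j) : GaugeField.plaqHol S p = 1 := by
  rw [plaqHol_eq_sgn_d₁ S hS p]
  split_ifs with hc
  · rfl
  · exfalso
    have hlt := hsmall p
    rw [plaqHol_eq_sgn_d₁ S hS p, if_neg hc, dist1_negOne_eq_two] at hlt
    exact absurd hlt (not_lt.2 hδ)

/-- ★★★ **EVERY CASE-B `2`-SMALL DATUM IS A GAUGE TRANSFORM OF A SEAM SECTOR**: if all closed-walk holonomies of `V` at a base point are central and
`PlaqSmall δ V`, `δ ≤ 2`, then `V = g • ζ_l` for a gauge transformation `g` and a duplicate-free list `l` of directions (✓`exists_gauge_centralValued_of_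
loopHol_central` ∘ the ℤ₂ normal form). [cite: Balaban1985Variational, (4)-(6) p.278] -/
theorem exists_gauge_seamFold_of_loopHol_central (V : GaugeField P j (Matrix.specialUnitaryGroup (Fin 2) ℂ)) (x₀ : Site P j)
    (hcen : ∀ w : List (Letter P.d), walkEnd x₀ w = x₀ →
      ∀ M : Matrix (Fin 2) (Fin 2) ℂ, Commute ((holAt V (walk x₀ w) : Matrix.specialUnitaryGroup (Fin 2) ℂ) : Matrix (Fin 2) (Fin 2) ℂ) M)
    {δ : ℝ} (hδ : δ ≤ 2) (hV : PlaqSmall δ V) :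
    ∃ (g : GaugeTransf P j (Matrix.specialUnitaryGroup (Fin 2) ℂ)) (l : List (Fin P.d)), l.Nodup ∧
      V = GaugeField.gaugeAct g (l.foldr (fun (ν : Fin P.d) (X : GaugeField P j (Matrix.specialUnitaryGroup (Fin 2) ℂ)) => fun b : PBond P j =>
        (if b.dir = ν ∧ (b.src ν).val + 1 = P.sitesPerDir j then (⟨-1, neg_one_mem⟩ : Matrix.specialUnitaryGroup (Fin 2) ℂ) else 1) * X b) (1 : GaugeField P j (Matrix.specialUnitaryGroup (Fin 2) ℂ))) := by
  obtain ⟨w, S, hScen, hSsmall, hVS⟩ := exists_gauge_centralValued_of_loopHol_central V x₀ hcen hV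
  have hS : ∀ c, S c = 1 ∨ S c = ⟨-1, neg_one_mem⟩ := fun c => eq_one_or_eq_negOne_of_central (S c) (hScen c)
  obtain ⟨g, l, hl, -, hSg⟩ := exists_gauge_seamFold_of_flat S hS (plaqHol_eq_one_of_central S hS hδ hSsmall)
  exact ⟨fun x => w x * g x, l, hl, by rw [hVS, hSg, gaugeAct_gaugeAct]⟩

end NormalForm

/-! ## §2 The T³ family: TUBE♭ ∕ GAP♭ OUTRIGHT at every case-B window datum -/

/-- ★★★★ **TUBE♭ OUTRIGHT AT EVERY CASE-B DATUM**: for every window-level datum `V` whose closed-walk holonomies are central and with `PlaqSmall δ V`,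
`δ ≤ 2`, there are a gauge transformation `g` and a duplicate-free `l` with `V = g • ζ_l^J`, and TUBE♭ holds at `(V, (liftTransfTo g) • ζ_l^K)` for every
radius `δ'` — same `γ₁(L, b₀, p₀)`, same `μ` as ✓px12 `exists_tubeGrowth_flat` at `(1,1)`; NO letter, any `L`.
[cite: Balaban1985Variational, (142) p.299, Thm 1 (8) p.279, (4)-(6) p.278; Balaban1985UV3, (12)-(13) p.259, (18)-(22) p.260] -/
theorem exists_tubeGrowth_caseB (L : ℕ) (b₀ p₀ : ℝ) (hb : 0 < b₀) (hp : 0 < p₀) :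
    ∃ γ₁ : ℝ, 0 < γ₁ ∧ ∀ (F : T3Family) (γ : ℝ), F.L = L → 0 < γ → γ ≤ γ₁ →
      ∀ (J K : ℕ) (hlt : J < K) (hk : K - J ≤ (F.P K).m + (F.P K).K)
        (ε₀ : ℝ), 0 < ε₀ → (143 * ((((3 + 4 : ℕ) : ℝ)) ^ 2 / 4) ^ 2) * (2 * ε₀) ≤ 1 / 3 →
          2 * (2 * ε₀) ≤ 2 * deltaSU (Fin 2) / (((3 + 4) * F.L : ℕ) : ℝ) ^ 2 →
        ∀ (V : GaugeField (F.P J) 0 (Matrix.specialUnitaryGroup (Fin 2) ℂ)) (x₀ : Site (F.P J) 0),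
          (∀ w : List (Letter (F.P J).d), walkEnd x₀ w = x₀ →
            ∀ M : Matrix (Fin 2) (Fin 2) ℂ, Commute ((holAt V (walk x₀ w) : Matrix.specialUnitaryGroup (Fin 2) ℂ) : Matrix (Fin 2) (Fin 2) ℂ) M) →
          ∀ δ : ℝ, δ ≤ 2 → PlaqSmall δ V →
          ∀ δ' : ℝ, ∃ (g : GaugeTransf (F.P J) 0 (Matrix.specialUnitaryGroup (Fin 2) ℂ)) (l : List (Fin 3)), l.Nodup ∧
            V = GaugeField.gaugeAct g (l.foldr (fun (ν : Fin 3) (X : GaugeField (F.P J) 0 (Matrix.specialUnitaryGroup (Fin 2) ℂ)) => fun c : PBond (F.P J) 0 =>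
            (if c.dir = ν ∧ (c.src ν).val + 1 = (F.P J).sitesPerDir 0 then (⟨-1, neg_one_mem⟩ : Matrix.specialUnitaryGroup (Fin 2) ℂ) else 1) * X c) (1 : GaugeField (F.P J) 0 (Matrix.specialUnitaryGroup (Fin 2) ℂ))) ∧
          ∃ μ : ℝ, 0 < μ ∧ ∀ U ∈ fibre F ℰp J K hlt.le V,
            U ∈ histGood F ℰp (θBal F.L γ b₀ p₀) K J →
          (∃ w : Site (F.P K) 0 → Matrix.specialUnitaryGroup (Fin 2) ℂ,
          (∀ U'' : GaugeField (F.P K) 0 (Matrix.specialUnitaryGroup (Fin 2) ℂ),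
          descendTo F ℰp J K hlt.le (GaugeField.gaugeAct w U'') = descendTo F ℰp J K hlt.le U'') ∧
          ∀ ℓ : PBond (F.P K) 0, dist1 (U ℓ * ((GaugeField.gaugeAct w
            (GaugeField.gaugeAct (liftTransfTo F J K hlt.le g) (l.foldr (fun (ν : Fin 3) (X : GaugeField (F.P K) 0 (Matrix.specialUnitaryGroup (Fin 2) ℂ)) => fun b : PBond (F.P K) 0 =>
            (if b.dir = ν ∧ (b.src ν).val + 1 = (F.P K).sitesPerDir 0 then (⟨-1, neg_one_mem⟩ : Matrix.specialUnitaryGroup (Fin 2) ℂ) else 1) * X b) (1 : GaugeField (F.P K) 0 (Matrix.specialUnitaryGroup (Fin 2) ℂ))))) ℓ)⁻¹) ≤ δ') →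
          μ * ((F.L : ℝ)⁻¹) ^ (2 * (K - J)) *
          (⨅ w : {w : Site (F.P K) 0 → Matrix.specialUnitaryGroup (Fin 2) ℂ |
          ∀ U : GaugeField (F.P K) 0 (Matrix.specialUnitaryGroup (Fin 2) ℂ),
          descendTo F ℰp J K hlt.le (GaugeField.gaugeAct w U) = descendTo F ℰp J K hlt.le U},
          ∑ ℓ : PBond (F.P K) 0,
          dist1 (U ℓ * ((GaugeField.gaugeAct (w : Site (F.P K) 0 → Matrix.specialUnitaryGroup (Fin 2) ℂ)
            (GaugeField.gaugeAct (liftTransfTo F J K hlt.le g) (l.foldr (fun (ν : Fin 3) (X : GaugeField (F.P K) 0 (Matrix.specialUnitaryGroup (Fin 2) ℂ)) => fun b : PBond (F.P K) 0 =>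
            (if b.dir = ν ∧ (b.src ν).val + 1 = (F.P K).sitesPerDir 0 then (⟨-1, neg_one_mem⟩ : Matrix.specialUnitaryGroup (Fin 2) ℂ) else 1) * X b) (1 : GaugeField (F.P K) 0 (Matrix.specialUnitaryGroup (Fin 2) ℂ))))) ℓ)⁻¹) ^ 2)
          ≤ wilsonAction4 U - minActionRegPr F J K hlt.le ε₀ V := by
  obtain ⟨γ₁, hγ₁, hmain⟩ := exists_tubeGrowth_seamSector L b₀ p₀ hb hp
  refine ⟨γ₁, hγ₁, ?_⟩
  intro F γ hFL hγ hγle J K hlt hk ε₀ hε₀ hr3 hr2 V x₀ hcen δ hδ hV δ'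
  obtain ⟨g, l, hl, hVg⟩ := exists_gauge_seamFold_of_loopHol_central V x₀ hcen hδ hV
  obtain ⟨μ, hμ, htube⟩ := hmain F γ hFL hγ hγle J K hlt hk ε₀ hε₀ hr3 hr2 g l δ'
  refine ⟨g, l, hl, hVg, μ, hμ, ?_⟩
  rw [hVg]
  exact htube

/-- ★★★★ **GAP♭ OUTRIGHT AT EVERY CASE-B DATUM** (`γ ≤ γ₁(L, b₀, p₀, δ')`; same `γ₁`, same `μ` as ✓px12 `exists_gapFlat_flat` at `(1,1)`).  NO letter, any `L`.
[cite: Balaban1985Variational, (142) p.299, Thm 1 (8) p.279, (4)-(6) p.278; Balaban1984PropagatorsII, (1.33); Balaban1985UV3, (12)-(13) p.259] -/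
theorem exists_gapFlat_caseB (L : ℕ) (b₀ p₀ : ℝ) (hb : 0 < b₀) (hp : 0 < p₀) (δ' : ℝ) (hδ' : 0 < δ') :
    ∃ γ₁ : ℝ, 0 < γ₁ ∧ ∀ (F : T3Family) (γ : ℝ), F.L = L → 0 < γ → γ ≤ γ₁ →
      ∀ (J K : ℕ) (hlt : J < K) (hk : K - J ≤ (F.P K).m + (F.P K).K)
        (ε₀ : ℝ), 0 < ε₀ → (143 * ((((3 + 4 : ℕ) : ℝ)) ^ 2 / 4) ^ 2) * (2 * ε₀) ≤ 1 / 3 →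
          2 * (2 * ε₀) ≤ 2 * deltaSU (Fin 2) / (((3 + 4) * F.L : ℕ) : ℝ) ^ 2 →
        ∀ (V : GaugeField (F.P J) 0 (Matrix.specialUnitaryGroup (Fin 2) ℂ)) (x₀ : Site (F.P J) 0),
          (∀ w : List (Letter (F.P J).d), walkEnd x₀ w = x₀ →
            ∀ M : Matrix (Fin 2) (Fin 2) ℂ, Commute ((holAt V (walk x₀ w) : Matrix.specialUnitaryGroup (Fin 2) ℂ) : Matrix (Fin 2) (Fin 2) ℂ) M) →
          ∀ δ : ℝ, δ ≤ 2 → PlaqSmall δ V →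
          ∃ (g : GaugeTransf (F.P J) 0 (Matrix.specialUnitaryGroup (Fin 2) ℂ)) (l : List (Fin 3)), l.Nodup ∧
            V = GaugeField.gaugeAct g (l.foldr (fun (ν : Fin 3) (X : GaugeField (F.P J) 0 (Matrix.specialUnitaryGroup (Fin 2) ℂ)) => fun c : PBond (F.P J) 0 =>
            (if c.dir = ν ∧ (c.src ν).val + 1 = (F.P J).sitesPerDir 0 then (⟨-1, neg_one_mem⟩ : Matrix.specialUnitaryGroup (Fin 2) ℂ) else 1) * X c) (1 : GaugeField (F.P J) 0 (Matrix.specialUnitaryGroup (Fin 2) ℂ))) ∧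
          ∃ μ : ℝ, 0 < μ ∧ ∀ U ∈ fibre F ℰp J K hlt.le V,
          U ∈ histGood F ℰp (θBal F.L γ b₀ p₀) K J →
        μ * ((F.L : ℝ)⁻¹) ^ (2 * (K - J)) *
        (⨅ w : {w : Site (F.P K) 0 → Matrix.specialUnitaryGroup (Fin 2) ℂ |
        ∀ U : GaugeField (F.P K) 0 (Matrix.specialUnitaryGroup (Fin 2) ℂ),
        descendTo F ℰp J K hlt.le (GaugeField.gaugeAct w U) = descendTo F ℰp J K hlt.le U},
        ∑ ℓ : PBond (F.P K) 0,
        dist1 (U ℓ * ((GaugeField.gaugeAct (w : Site (F.P K) 0 → Matrix.specialUnitaryGroup (Fin 2) ℂ)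
          (GaugeField.gaugeAct (liftTransfTo F J K hlt.le g) (l.foldr (fun (ν : Fin 3) (X : GaugeField (F.P K) 0 (Matrix.specialUnitaryGroup (Fin 2) ℂ)) => fun b : PBond (F.P K) 0 =>
            (if b.dir = ν ∧ (b.src ν).val + 1 = (F.P K).sitesPerDir 0 then (⟨-1, neg_one_mem⟩ : Matrix.specialUnitaryGroup (Fin 2) ℂ) else 1) * X b) (1 : GaugeField (F.P K) 0 (Matrix.specialUnitaryGroup (Fin 2) ℂ))))) ℓ)⁻¹) ^ 2)
        ≤ wilsonAction4 U - minActionRegPr F J K hlt.le ε₀ V := by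
  obtain ⟨γ₁, hγ₁, hmain⟩ := exists_gapFlat_seamSector L b₀ p₀ hb hp δ' hδ'
  refine ⟨γ₁, hγ₁, ?_⟩
  intro F γ hFL hγ hγle J K hlt hk ε₀ hε₀ hr3 hr2 V x₀ hcen δ hδ hV
  obtain ⟨g, l, hl, hVg⟩ := exists_gauge_seamFold_of_loopHol_central V x₀ hcen hδ hV
  obtain ⟨μ, hμ, hgap⟩ := hmain F γ hFL hγ hγle J K hlt hk ε₀ hε₀ hr3 hr2 g l
  refine ⟨g, l, hl, hVg, μ, hμ, ?_⟩
  rw [hVg]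
  exact hgap

end Summit.QuantumFields.YangMills.Theorems.FluctuationComparisonRegPrIntLS2BetaSeamSectorNormalForm

end
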